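import Literature.NumberTheory.Transcendental.ZeroEstDescent
import Literature.NumberTheory.Transcendental.ZeroEstMultiplicity
import Literature.NumberTheory.Transcendental.ZeroEstBezout
import Mathlib.RingTheory.GradedAlgebra.Radical
import HarnessLib

/-!
# Zero estimates on commutative algebraic groups, XVI: Philippon's zero estimate for an analytic group model

Topic `Literature/NumberTheory/Transcendental`. Sixteenth module of the discharge of
`Literature.NumberTheory.Transcendental.philippon1986_std`: D. Roy's form of Philippon's zero
estimate (Nesterenko–Philippon (eds.), LNM 1752, Ch. 11, Thm. 4.1) for an abstract analytic
group model `M : AnalyticGroupModel V N`, assembled from the descent (`ZeroEstDescent.lean`),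
the multiplicity estimate at each coset (`coset_multiplicity`: `ZeroEstTransversal.lean`,
`ZeroEstMultiplicity.lean`, `ZeroEstQuotientDerivations.lean`), thick additivity and the lossy
Bézout chain (`ZeroEstHilbert.lean`, `ZeroEstBezout.lean`) and the comparison of leading
coefficients `GaGm.Asymp.sum_le_of_choose_ineq` — the tree's `PhilipponZeroEstimateHolds.lean`
transplanted.

**Main theorem** (`zero_estimate`). There is a natural number `c₀ = c₀(M)` such that for every
subspace `W ⊆ V`, every finite `Σ ∋ 0`, every form `P` of degree `D` with `F_P ≢ 0` vanishing
to order `> nT` along `W` at the points of `Σ(n)` (`n = dim G`), there is a closed irreducible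
subgroup `H₀ ⊆ V` (for the `Θ`-Zariski topology) and a point `v₀` with `F_P(v₀ + h) = 0`
(`h ∈ H₀`) such that

`binom(T + s, s) · card{σ + H₀ ; σ ∈ Σ} · D^{coneDim H₀ - 1} ≤ c₀ · Dⁿ`,

`s = dim W - dim (W ∩ 𝒯(H₀))` with `𝒯` the lineality space (`linSpace`). (The exponent
`coneDim H₀ - 1 = dim H₀` and the count of cosets are read off in the model; for the theta model of
`M_κ` see the sequel.)

## References

* Yu. V. Nesterenko, P. Philippon (eds.), *Introduction to Algebraic Independence Theory*,
  LNM 1752, Springer 2001, Ch. 11 (D. Roy), Thm. 4.1 and its proof (pp. 218–221). [NesterenkoPhilippon2001]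
* P. Philippon, *Lemmes de zéros dans les groupes algébriques commutatifs*, Bull. Soc. Math.
  France 114 (1986), 355–383, Thm. 2.1. [Philippon1986]
-/

noncomputable section

open MvPolynomial Set Module
open scoped Pointwise

namespace Literature.NumberTheory.Transcendental

namespace AnalyticGroupModel

variable {V : Type*} [NormedAddCommGroup V] [NormedSpace ℂ V] [CompleteSpace V] [FiniteDimensional ℂ V]
  {N : ℕ} (M : AnalyticGroupModel V N)

attribute [local instance] MvPolynomial.gradedAlgebra

/-! ### The multiplicity estimate at a coset (Prop. 3.8) -/

omit [CompleteSpace V] in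
/-- A complement of `W ∩ L` in `W`: linearly independent `x_1, …, x_s ∈ W`, `s = dim W - dim (W ∩ L)`,
spanning a space transversal to `L`. [folklore] -/
theorem exists_complement_basis (W L : Submodule ℂ V) :
    ∃ x : Fin (finrank ℂ W - finrank ℂ ↥(W ⊓ L)) → V, LinearIndependent ℂ x ∧ (∀ i, x i ∈ W) ∧
      Submodule.span ℂ (Set.range x) ⊓ L = ⊥ := by
  set U : Submodule ℂ ↥W := L.comap W.subtype with hU
  obtain ⟨U', hUU'⟩ := Submodule.exists_isCompl U
  have hdimU : finrank ℂ U = finrank ℂ ↥(W ⊓ L) := by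
    have e : U.map W.subtype = W ⊓ L := by
      ext y
      simp only [Submodule.mem_map, Submodule.mem_comap, Submodule.coe_subtype, hU, Submodule.mem_inf]
      constructor
      · rintro ⟨z, hz, rfl⟩; exact ⟨z.2, hz⟩
      · rintro ⟨hy, hy'⟩; exact ⟨⟨y, hy⟩, hy', rfl⟩
    rw [← e, Submodule.finrank_map_subtype_eq]
  have hdimU' : finrank ℂ U' = finrank ℂ W - finrank ℂ ↥(W ⊓ L) := by
    have := Submodule.finrank_add_eq_of_isCompl hUU'
    rw [hdimU] at this
    have hW : finrank ℂ (↥W) = finrank ℂ W := rfl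
    omega
  set b := Module.finBasisOfFinrankEq ℂ U' hdimU' with hb
  refine ⟨fun i => ((b i : U') : ↥W), ?_, fun i => ((b i : U') : ↥W).2, ?_⟩
  · have h1 : LinearIndependent ℂ (fun i => ((b i : U') : ↥W)) :=
      b.linearIndependent.map' U'.subtype (Submodule.ker_subtype U')
    exact h1.map' W.subtype (Submodule.ker_subtype W)
  · rw [Submodule.eq_bot_iff]
    rintro y ⟨hy, hyL⟩
    -- `y ∈ W`, and as an element of `W` it lies in `U' ∩ U = 0`
    have hyspan : y ∈ (U'.map W.subtype : Submodule ℂ V) := by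
      refine Submodule.span_le.mpr ?_ hy
      rintro _ ⟨i, rfl⟩
      exact ⟨(b i : U'), (b i).2, rfl⟩
    obtain ⟨z, hzU', rfl⟩ := hyspan
    have hzU : z ∈ U := by
      rw [hU, Submodule.mem_comap]; exact hyL
    have : z ∈ U ⊓ U' := ⟨hzU, hzU'⟩
    rw [hUU'.inf_eq_bot, Submodule.mem_bot] at this
    rw [this]; rfl

omit [CompleteSpace V] in
/-- **The multiplicity estimate at a coset** (Roy's Prop. 3.8 for one component): for a relevant
homogeneous prime `𝔭 ⊇ 𝔊` whose zero set `Y` is stable under the differences of its points, a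
homogeneous ideal `𝔄` whose members vanish to order `> T` along `W` at every point of
`Y`, and `s = dim W - dim (W ∩ 𝒯(Y))`: `binom(T + s, s) · H_𝔭(t) ≤ H_{loc 𝔭 𝔄}(t + c'T)` for some
`c'` and all `t`. [cite: NesterenkoPhilippon2001, Ch. 11 Prop. 3.8] -/
theorem coset_multiplicity {W : Submodule ℂ V} {𝔭 𝔄 : Ideal (MvPolynomial (Fin (N + 1)) ℂ)} (h𝔭 : 𝔭.IsPrime)
    (hhom : 𝔭.IsHomogeneous (homogeneousSubmodule (Fin (N + 1)) ℂ)) (h𝔊 : M.relIdeal ≤ 𝔭) (hrel : M.IsRelevant 𝔭)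
    (h𝔄hom : 𝔄.IsHomogeneous (homogeneousSubmodule (Fin (N + 1)) ℂ))
    {σ : V} (hσ : σ ∈ M.zeroSet ((𝔭 : Ideal _) : Set (MvPolynomial (Fin (N + 1)) ℂ)))
    (hstab : ∀ w ∈ M.zeroSet ((𝔭 : Ideal _) : Set (MvPolynomial (Fin (N + 1)) ℂ)),
      ∀ v ∈ M.zeroSet ((𝔭 : Ideal _) : Set (MvPolynomial (Fin (N + 1)) ℂ)),
        v + (w - σ) ∈ M.zeroSet ((𝔭 : Ideal _) : Set (MvPolynomial (Fin (N + 1)) ℂ)))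
    {T : ℕ} (hvan : ∀ Q ∈ 𝔄, ∀ a ∈ M.zeroSet ((𝔭 : Ideal _) : Set (MvPolynomial (Fin (N + 1)) ℂ)),
      VanishesToOrder W (M.F Q) a (T + 1)) :
    ∃ c' : ℕ, ∀ t,
      (T + (finrank ℂ W - finrank ℂ ↥(W ⊓ linSpace (M.zeroSet ((𝔭 : Ideal _) : Set (MvPolynomial (Fin (N + 1)) ℂ)))))).choose
          (finrank ℂ W - finrank ℂ ↥(W ⊓ linSpace (M.zeroSet ((𝔭 : Ideal _) : Set (MvPolynomial (Fin (N + 1)) ℂ))))) *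
        ZeroEst.hilbC (𝔭.restrictScalars ℂ) t ≤
      ZeroEst.hilbC (N := N) ((GaGm.loc 𝔭 h𝔭 𝔄).restrictScalars ℂ) (t + c' * T) := by
  classical
  haveI := h𝔭
  set Y := M.zeroSet ((𝔭 : Ideal _) : Set (MvPolynomial (Fin (N + 1)) ℂ)) with hY
  -- the chart at `σ`
  obtain ⟨J₀, hΘσ⟩ := M.exists_Θ_ne_zero σ
  have hJ₀ : (X J₀ : MvPolynomial (Fin (N + 1)) ℂ) ∉ 𝔭 := fun hmem => by
    have := M.F_eq_zero_of_mem_of_mem_zeroSet hmem hσ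
    rw [F_X] at this
    exact hΘσ this
  -- a transversal basis
  set s := finrank ℂ W - finrank ℂ ↥(W ⊓ linSpace Y) with hs
  obtain ⟨x, hxli, hxW, hxtr⟩ := exists_complement_basis W (linSpace Y)
  -- the transversal equations (Step 2)
  obtain ⟨G, hG𝔭, hoff, hdiag⟩ := M.exists_transversal hhom h𝔊 hrel hσ hΘσ hstab hxli hxtr
  -- the derivations of `A`
  set d : Fin s → Derivation ℂ M.Quot M.Quot := fun i => M.quotDer J₀ (x i) with hd
  have hcomm : ∀ i j (a : M.Quot), d i (d j a) = d j (d i a) := fun i j a => M.quotDer_comm hΘσ (x i) (x j) a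
  have hmem𝔭 : ∀ {y : MvPolynomial (Fin (N + 1)) ℂ},
      Ideal.Quotient.mk M.relIdeal y ∈ 𝔭.map (Ideal.Quotient.mk M.relIdeal) ↔ y ∈ 𝔭 := by
    intro y
    rw [← Ideal.mem_comap, Ideal.comap_map_of_surjective _ Ideal.Quotient.mk_surjective,
      ← RingHom.ker_eq_comap_bot, Ideal.mk_ker, sup_eq_left.mpr h𝔊]
  have hoff' : ∀ i j, i ≠ j → d i (Ideal.Quotient.mk M.relIdeal (G j)) ∈ 𝔭.map (Ideal.Quotient.mk M.relIdeal) := by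
    intro i j hij
    change M.quotDer J₀ (x i) (Ideal.Quotient.mk M.relIdeal (G j)) ∈ _
    rw [quotDer_mk]
    exact hmem𝔭.mpr (hoff i j hij)
  have hdiag' : ∀ i, d i (Ideal.Quotient.mk M.relIdeal (G i)) ∉ 𝔭.map (Ideal.Quotient.mk M.relIdeal) := by
    intro i hmem
    change M.quotDer J₀ (x i) (Ideal.Quotient.mk M.relIdeal (G i)) ∈ _ at hmem
    rw [quotDer_mk] at hmem
    exact hdiag i (hmem𝔭.mp hmem)
  -- degrees
  set c' := Finset.univ.sup fun i => (G i).totalDegree with hc'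
  have hGdeg : ∀ i, G i ∈ ZeroEst.Fil (N := N) c' := fun i =>
    ZeroEst.mem_Fil.mpr (Finset.le_sup (f := fun i => (G i).totalDegree) (Finset.mem_univ i))
  -- Step 1
  have H𝔮 : ∀ Q ∈ GaGm.loc 𝔭 h𝔭 𝔄, ∀ μ : Fin s → ℕ, MultiplicityLemma.order μ ≤ T →
      MultiplicityLemma.opPow d μ (Ideal.Quotient.mk M.relIdeal Q) ∈ 𝔭.map (Ideal.Quotient.mk M.relIdeal) := by
    intro Q hQ μ hμ
    change MultiplicityLemma.opPow (fun i => M.quotDer J₀ (x i)) μ (Ideal.Quotient.mk M.relIdeal Q) ∈ _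
    rw [← M.mk_opPow J₀ x μ Q]
    exact Ideal.mem_map_of_mem _ (M.opPow_mem_of_mem_loc h𝔭 hhom h𝔊 hrel h𝔄hom hJ₀ hvan hxW hQ hμ)
  refine ⟨c', fun t => ?_⟩
  exact M.choose_mul_hilbC_le h𝔭 h𝔊 hcomm hG𝔭 hGdeg hoff' hdiag' H𝔮 t

/-! ### Finite generation of `𝔄` modulo `𝔊` in degree `c·D` -/

omit [CompleteSpace V] [FiniteDimensional ℂ V] in
/-- A finite subset of `derivGens` with the same span. [folklore] -/
theorem exists_finset_span_eq (W : Submodule ℂ V) {P : MvPolynomial (Fin (N + 1)) ℂ} {D : ℕ} (hP : P.IsHomogeneous D)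
    (Γ : Set V) (T : ℕ) :
    ∃ Fs : Finset (MvPolynomial (Fin (N + 1)) ℂ), (↑Fs : Set (MvPolynomial (Fin (N + 1)) ℂ)) ⊆ M.derivGens W P Γ T ∧
      Submodule.span ℂ (↑Fs : Set (MvPolynomial (Fin (N + 1)) ℂ)) = Submodule.span ℂ (M.derivGens W P Γ T) := by
  obtain ⟨b, hbsub, hbspan, hbli⟩ := exists_linearIndependent ℂ (M.derivGens W P Γ T)
  haveI : Module.Finite ℂ ↥(homogeneousSubmodule (Fin (N + 1)) ℂ (M.lawDeg * D)) :=
    Module.Finite.iff_fg.mpr (homogeneousSubmodule_fg (Fin (N + 1)) ℂ _)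
  have hble : ∀ y ∈ b, y ∈ homogeneousSubmodule (Fin (N + 1)) ℂ (M.lawDeg * D) := fun y hy =>
    (mem_homogeneousSubmodule _ _).mpr (M.isHomogeneous_of_mem_derivGens hP (hbsub hy))
  have hbfin : b.Finite := by
    have h1 : LinearIndependent ℂ (fun y : b => (⟨(y : MvPolynomial (Fin (N + 1)) ℂ), hble y y.2⟩ :
        ↥(homogeneousSubmodule (Fin (N + 1)) ℂ (M.lawDeg * D)))) := by
      refine LinearIndependent.of_comp (homogeneousSubmodule (Fin (N + 1)) ℂ (M.lawDeg * D)).subtype ?_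
      exact hbli
    exact Set.finite_coe_iff.mp h1.finite
  refine ⟨hbfin.toFinset, by rwa [Set.Finite.coe_toFinset], by rw [Set.Finite.coe_toFinset, hbspan]⟩

/-! ### The zero estimate -/

/-- **The constant `c₀(M)`** of the zero estimate. [cite: NesterenkoPhilippon2001, Ch. 11 Thm. 4.1] -/
def mainConst : ℕ :=
  2 ^ ((M.dim + 1) * (M.dim + 1)) * M.lawDeg ^ (M.dim + 1) * M.hilbConst * (M.dim + 1).factorial

/-- **Philippon's zero estimate for an analytic group model** (Roy's Thm. 4.1, constant not
specified). [cite: NesterenkoPhilippon2001, Ch. 11 Thm. 4.1] [cite: Philippon1986, Thm. 2.1] -/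
theorem zero_estimate (W : Submodule ℂ V) {S : Set V} (hSfin : S.Finite) (h0 : (0 : V) ∈ S)
    {P : MvPolynomial (Fin (N + 1)) ℂ} {D T : ℕ} (hP : P.IsHomogeneous D) (hP0 : ∃ w, M.F P w ≠ 0)
    (hvan : ∀ σ ∈ sumset S M.dim, VanishesToOrder W (M.F P) σ (M.dim * T + 1)) :
    ∃ H₀ : AddSubgroup V, M.IsClosedG (H₀ : Set V) ∧ M.IsIrred (H₀ : Set V) ∧
      (∃ v₀, ∀ h ∈ H₀, M.F P (v₀ + h) = 0) ∧
      (T + (finrank ℂ W - finrank ℂ ↥(W ⊓ linSpace ((H₀ : AddSubgroup V) : Set V)))).choose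
          (finrank ℂ W - finrank ℂ ↥(W ⊓ linSpace ((H₀ : AddSubgroup V) : Set V))) *
        ((fun σ => σ +ᵥ ((H₀ : AddSubgroup V) : Set V)) '' S).ncard *
        D ^ (M.coneDim ((H₀ : AddSubgroup V) : Set V) - 1) ≤ M.mainConst * D ^ M.dim := by
  classical
  have hc : 1 ≤ M.lawDeg := M.lawDeg_pos
  set n := M.dim with hn
  obtain ⟨St, hStcl, Γ, k, v₀, hzero, hSE, hH₀St, hcosE, hdimcos, hdT, hdimEn, hdimEH⟩ :=
    M.exists_descent_data W h0 T hP hP0 hvan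
  set H₀ : AddSubgroup V := M.idComp St hStcl with hH₀
  set 𝔄 := M.dIdeal W P Γ (k * T) with h𝔄
  set E := M.zeroSet (𝔄 : Set (MvPolynomial (Fin (N + 1)) ℂ)) with hE
  have hirr : M.IsIrred ((H₀ : AddSubgroup V) : Set V) := M.isIrred_idComp St hStcl
  set s := finrank ℂ W - finrank ℂ ↥(W ⊓ linSpace ((H₀ : AddSubgroup V) : Set V)) with hs
  set m₀ := M.coneDim ((H₀ : AddSubgroup V) : Set V) with hm₀
  refine ⟨H₀, hirr.isClosedG, hirr, ⟨v₀, hzero⟩, ?_⟩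
  -- basic facts on `𝔄` and `E`
  have h𝔄hom : 𝔄.IsHomogeneous (homogeneousSubmodule (Fin (N + 1)) ℂ) := M.isHomogeneous_dIdeal hP Γ (k * T)
  have h𝔊𝔄 : M.relIdeal ≤ 𝔄 := M.relIdeal_le_dIdeal P Γ (k * T)
  have h𝔄spec : M.specialClosure 𝔄 = 𝔄 := M.specialClosure_dIdeal P Γ (k * T)
  have hEcl : M.IsClosedG E := M.isClosedG_zeroSet _
  have h𝔄E : 𝔄 ≤ M.vanishing E := fun f hf => M.subset_vanishing_zeroSet _ hf
  -- `𝔍(E) = √𝔄`: all minimal primes of the special ideal `𝔄` are relevant homogeneous primes `⊇ 𝔊`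
  have hminrel : ∀ 𝔮 ∈ 𝔄.minimalPrimes, M.IsRelevant 𝔮 := fun 𝔮 h𝔮 => by
    rw [← h𝔄spec] at h𝔮; exact M.isRelevant_of_mem_minimalPrimes_specialClosure h𝔮
  have hvanE : M.vanishing E = 𝔄.radical := by
    refine le_antisymm ?_ ?_
    · rw [← Ideal.sInf_minimalPrimes]
      refine le_sInf fun 𝔮 h𝔮 => ?_
      haveI := h𝔮.1.1
      have hq := M.vanishing_zeroSet_eq_of_isPrime (𝔭 := 𝔮)
        (Literature.RingTheory.MvPolynomial.isHomogeneous_of_mem_minimalPrimes h𝔄hom h𝔮)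
        (h𝔊𝔄.trans h𝔮.1.2) (hminrel 𝔮 h𝔮)
      rw [← hq]
      exact M.vanishing_antitone (M.zeroSet_antitone h𝔮.1.2)
    · exact (M.isRadical_vanishing E).radical_le_iff.mpr h𝔄E
  -- the cosets `σ + H₀`, `σ ∈ Σ`
  set 𝓨 : Finset (Set V) := hSfin.toFinset.image fun σ => σ +ᵥ ((H₀ : AddSubgroup V) : Set V) with h𝓨
  have hrep : ∀ Y ∈ 𝓨, ∃ σ ∈ S, Y = σ +ᵥ ((H₀ : AddSubgroup V) : Set V) := fun Y hY => by
    rw [h𝓨, Finset.mem_image] at hY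
    obtain ⟨σ, hσ, rfl⟩ := hY
    exact ⟨σ, hSfin.mem_toFinset.mp hσ, rfl⟩
  choose! rep hrepS hrepY using hrep
  have h0𝓨 : (0 : V) +ᵥ ((H₀ : AddSubgroup V) : Set V) ∈ 𝓨 := by
    rw [h𝓨, Finset.mem_image]; exact ⟨0, hSfin.mem_toFinset.mpr h0, rfl⟩
  haveI : Nonempty ↥𝓨 := ⟨⟨_, h0𝓨⟩⟩
  have hYirr : ∀ Y : ↥𝓨, M.IsIrred (Y : Set V) := fun Y => by rw [hrepY Y Y.2]; exact hirr.vadd M _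
  have hYE : ∀ Y : ↥𝓨, (Y : Set V) ⊆ E := fun Y => by rw [hrepY Y Y.2]; exact hcosE _ (hrepS Y Y.2)
  have hYdim : ∀ Y : ↥𝓨, M.coneDim (Y : Set V) = m₀ := fun Y => by
    rw [hrepY Y Y.2, hdimcos _ (hrepS Y Y.2), hdimEH]
  have hYdT : ∀ Y : ↥𝓨, ∀ a ∈ (Y : Set V), ∀ Q ∈ 𝔄, VanishesToOrder W (M.F Q) a (T + 1) := by
    intro Y a ha Q hQ
    rw [hrepY Y Y.2] at ha
    obtain ⟨h, hh, rfl⟩ := ha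
    exact hdT _ (hrepS Y Y.2) h (hH₀St hh) Q hQ
  -- the primes
  set 𝔭 : ↥𝓨 → Ideal (MvPolynomial (Fin (N + 1)) ℂ) := fun Y => M.vanishing (Y : Set V) with h𝔭
  have h𝔭p : ∀ Y, (𝔭 Y).IsPrime := fun Y => (hYirr Y).isPrime
  have h𝔭hom : ∀ Y, (𝔭 Y).IsHomogeneous (homogeneousSubmodule (Fin (N + 1)) ℂ) := fun Y => M.isHomogeneous_vanishing _
  have h𝔭𝔊 : ∀ Y, M.relIdeal ≤ 𝔭 Y := fun Y => M.vanishing_antitone (subset_univ _)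
  have h𝔭rel : ∀ Y, M.IsRelevant (𝔭 Y) := fun Y => M.isRelevant_vanishing (hYirr Y).nonempty
  have h𝔄le : ∀ Y, 𝔄 ≤ 𝔭 Y := fun Y => fun f hf => M.vanishing_antitone (hYE Y) (h𝔄E hf)
  have hYZ : ∀ Y : ↥𝓨, M.zeroSet ((𝔭 Y : Ideal _) : Set (MvPolynomial (Fin (N + 1)) ℂ)) = (Y : Set V) :=
    fun Y => (hYirr Y).isClosedG.eq
  have hmin : ∀ Y, 𝔭 Y ∈ 𝔄.minimalPrimes := fun Y => by
    obtain ⟨𝔮, h𝔮, hYeq, hv⟩ := (hYirr Y).exists_eq_zeroSet_minimalPrimes M hEcl (hYE Y) (by rw [hYdim, ← hdimEH])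
    rw [← Ideal.radical_minimalPrimes, ← hvanE, show 𝔭 Y = 𝔮 from hv]
    exact h𝔮
  have hrad : ∀ Y, ∃ Mm : ℕ, 𝔭 Y ^ Mm ≤ GaGm.loc (𝔭 Y) (h𝔭p Y) 𝔄 := fun Y =>
    GaGm.exists_pow_le_loc_of_mem_minimalPrimes (hmin Y)
  have hinc : ∀ Y Y' : ↥𝓨, 𝔭 Y ≤ 𝔭 Y' → Y = Y' := fun Y Y' hle => by
    have hsub : (Y' : Set V) ⊆ Y := by
      rw [← (hYirr Y').isClosedG.eq, ← (hYirr Y).isClosedG.eq]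
      exact M.zeroSet_antitone hle
    have heq := (hYirr Y).eq_of_subset_of_coneDim_eq M (hYirr Y').isClosedG (hYirr Y').nonempty hsub
      (by rw [hYdim, hYdim])
    exact Subtype.ext heq.symm
  -- the multiplicity estimate at each coset
  have hcount : ∀ Y : ↥𝓨, ∃ cY : ℕ, ∀ t,
      (T + s).choose s * ZeroEst.hilbC ((𝔭 Y).restrictScalars ℂ) t ≤
        ZeroEst.hilbC (N := N) ((GaGm.loc (𝔭 Y) (h𝔭p Y) 𝔄).restrictScalars ℂ) (t + cY * T) := by
    intro Y
    have eY : M.zeroSet ((𝔭 Y : Ideal _) : Set (MvPolynomial (Fin (N + 1)) ℂ)) = rep Y +ᵥ ((H₀ : AddSubgroup V) : Set V) :=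
      (hYZ Y).trans (hrepY Y Y.2)
    have hσY : rep Y ∈ M.zeroSet ((𝔭 Y : Ideal _) : Set (MvPolynomial (Fin (N + 1)) ℂ)) := by
      rw [eY]; exact ⟨0, H₀.zero_mem, (vadd_eq_add _ _).trans (add_zero _)⟩
    have hstab : ∀ w ∈ M.zeroSet ((𝔭 Y : Ideal _) : Set (MvPolynomial (Fin (N + 1)) ℂ)),
        ∀ v ∈ M.zeroSet ((𝔭 Y : Ideal _) : Set (MvPolynomial (Fin (N + 1)) ℂ)),
          v + (w - rep Y) ∈ M.zeroSet ((𝔭 Y : Ideal _) : Set (MvPolynomial (Fin (N + 1)) ℂ)) := by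
      intro w hw v hv
      rw [eY] at hw hv ⊢
      obtain ⟨h₁, hh₁, rfl⟩ := hw
      obtain ⟨h₂, hh₂, rfl⟩ := hv
      refine ⟨h₂ + h₁, H₀.add_mem hh₂ hh₁, ?_⟩
      simp only [vadd_eq_add]; abel
    have hlin : linSpace (M.zeroSet ((𝔭 Y : Ideal _) : Set (MvPolynomial (Fin (N + 1)) ℂ))) =
        linSpace ((H₀ : AddSubgroup V) : Set V) := by
      rw [eY, linSpace_vadd]
    have hvanY : ∀ Q ∈ 𝔄, ∀ a ∈ M.zeroSet ((𝔭 Y : Ideal _) : Set (MvPolynomial (Fin (N + 1)) ℂ)),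
        VanishesToOrder W (M.F Q) a (T + 1) := fun Q hQ a ha => hYdT Y a (by rwa [hYZ] at ha) Q hQ
    obtain ⟨cY, hcY⟩ := M.coset_multiplicity (W := W) (h𝔭p Y) (h𝔭hom Y) (h𝔭𝔊 Y) (h𝔭rel Y) h𝔄hom hσY hstab hvanY
    refine ⟨cY, fun t => ?_⟩
    have := hcY t
    rwa [hlin] at this
  choose cY hcY using hcount
  -- the sandwich of each coset prime
  have hsand : ∀ Y : ↥𝓨, ∃ ρ a : ℕ, 1 ≤ ρ ∧ ∀ t, a ≤ t →
      ρ * (t - a + m₀).choose m₀ ≤ ZeroEst.hilbC (N := N) ((𝔭 Y).restrictScalars ℂ) t := by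
    intro Y
    haveI := h𝔭p Y
    have hd : ringKrullDim (MvPolynomial (Fin (N + 1)) ℂ ⧸ 𝔭 Y) = m₀ := by
      change ringKrullDim (MvPolynomial (Fin (N + 1)) ℂ ⧸ M.vanishing (Y : Set V)) = m₀
      rw [← M.coneDim_eq (hYirr Y).nonempty, hYdim]
    obtain ⟨ρ, a, γ, hρ, h⟩ := ZeroEst.exists_sandwich_of_isPrime hd
    exact ⟨ρ, a, hρ, fun t ht => (h t ht).1⟩
  choose ρY aY hρY haY using hsand
  -- thick additivity
  obtain ⟨δ, hδ⟩ := ZeroEst.exists_sum_hilbC_loc_le 𝔄 𝔭 h𝔭p hinc h𝔄le hrad Finset.univ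
  -- the generators in degree `cD` and the lossy Bézout bound
  obtain ⟨Fs, hFsF, hspanFs⟩ := M.exists_finset_span_eq W hP Γ (k * T)
  have hFgen𝔄 : M.derivGens W P Γ (k * T) ⊆ (𝔄 : Set (MvPolynomial (Fin (N + 1)) ℂ)) := M.derivGens_subset_dIdeal P Γ (k * T)
  have hspanFs𝔄 : M.relIdeal ⊔ Ideal.span (↑Fs : Set (MvPolynomial (Fin (N + 1)) ℂ)) ≤ 𝔄 :=
    sup_le h𝔊𝔄 (Ideal.span_le.mpr (hFsF.trans hFgen𝔄))
  -- `𝔄 = (𝔊 + (Fs))^*`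
  have h𝔄eq : 𝔄 = M.specialClosure (M.relIdeal ⊔ Ideal.span (↑Fs : Set (MvPolynomial (Fin (N + 1)) ℂ))) := by
    refine le_antisymm ?_ (by rw [← h𝔄spec]; exact M.specialClosure_mono hspanFs𝔄)
    rw [h𝔄, dIdeal]
    refine M.specialClosure_mono (sup_le_sup_left ?_ _)
    rw [Ideal.span_le]
    intro f hf
    have : f ∈ Submodule.span ℂ (M.derivGens W P Γ (k * T)) := Submodule.subset_span hf
    rw [← hspanFs] at this
    exact (Submodule.span_le.mpr (fun g hg => Ideal.subset_span hg) : Submodule.span ℂ (↑Fs : Set _) ≤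
      (Ideal.span (↑Fs : Set (MvPolynomial (Fin (N + 1)) ℂ))).restrictScalars ℂ) this
  have hm₀le : m₀ ≤ n := by rw [← hdimEH]; exact hdimEn
  have hm₀pos : 1 ≤ m₀ := M.one_le_coneDim hirr.nonempty
  set r' := n + 1 - m₀ with hr'
  have hr'le : r' ≤ n + 1 := Nat.sub_le _ _
  have hDH : ∀ 𝔭' : Ideal (MvPolynomial (Fin (N + 1)) ℂ), 𝔭'.IsPrime → (∃ Y, 𝔭' ≤ 𝔭 Y) →
      M.relIdeal ≤ 𝔭' → (↑Fs : Set (MvPolynomial (Fin (N + 1)) ℂ)) ⊆ 𝔭' →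
      ringKrullDim (MvPolynomial (Fin (N + 1)) ℂ ⧸ 𝔭') ≤ ((n + 1 - r' : ℕ) : WithBot ℕ∞) := by
    rintro 𝔭' h𝔭' ⟨Y, hle⟩ h𝔊' hFs
    -- pass to the homogeneous core `𝔭'* ⊆ 𝔭'`, a relevant homogeneous prime containing `𝔊 + (Fs)`
    haveI := h𝔭'
    set 𝔠 : Ideal (MvPolynomial (Fin (N + 1)) ℂ) := (𝔭'.homogeneousCore (homogeneousSubmodule (Fin (N + 1)) ℂ)).toIdeal with h𝔠
    haveI h𝔠p : 𝔠.IsPrime := h𝔭'.homogeneousCore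
    have h𝔠le : 𝔠 ≤ 𝔭' := Ideal.toIdeal_homogeneousCore_le _ 𝔭'
    have h𝔠hom : 𝔠.IsHomogeneous (homogeneousSubmodule (Fin (N + 1)) ℂ) := (𝔭'.homogeneousCore _).isHomogeneous
    have h𝔊𝔠 : M.relIdeal ≤ 𝔠 :=
      M.isHomogeneous_relIdeal.toIdeal_homogeneousCore_eq_self.symm.trans_le (Ideal.homogeneousCore_mono _ h𝔊')
    have hFs𝔠 : M.relIdeal ⊔ Ideal.span (↑Fs : Set (MvPolynomial (Fin (N + 1)) ℂ)) ≤ 𝔠 := by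
      have hhomJ : (M.relIdeal ⊔ Ideal.span (↑Fs : Set (MvPolynomial (Fin (N + 1)) ℂ))).IsHomogeneous
          (homogeneousSubmodule (Fin (N + 1)) ℂ) :=
        Ideal.IsHomogeneous.sup M.isHomogeneous_relIdeal (Ideal.homogeneous_span _ _ fun f hf =>
          ⟨_, M.isHomogeneous_of_mem_derivGens hP (hFsF hf)⟩)
      have hJle : M.relIdeal ⊔ Ideal.span (↑Fs : Set (MvPolynomial (Fin (N + 1)) ℂ)) ≤ 𝔭' :=
        sup_le h𝔊' (Ideal.span_le.mpr hFs)
      exact hhomJ.toIdeal_homogeneousCore_eq_self.symm.trans_le (Ideal.homogeneousCore_mono _ hJle)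
    have h𝔠rel : M.IsRelevant 𝔠 := by
      obtain ⟨u, hu, hu𝔭⟩ := h𝔭rel Y
      exact ⟨u, hu, fun h => hu𝔭 (hle (h𝔠le h))⟩
    -- `Z_G(𝔠) ⊆ Z_G(𝔊 + (Fs)) = Z_G(𝔄) = E`
    have hZ : M.zeroSet ((𝔠 : Ideal _) : Set (MvPolynomial (Fin (N + 1)) ℂ)) ⊆ E := by
      rw [hE, h𝔄eq, zeroSet_specialClosure]
      exact M.zeroSet_antitone hFs𝔠
    have hdim𝔠 : M.coneDim (M.zeroSet ((𝔠 : Ideal _) : Set (MvPolynomial (Fin (N + 1)) ℂ))) ≤ m₀ := by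
      rw [← hdimEH]; exact M.coneDim_mono hZ
    have hne : (M.zeroSet ((𝔠 : Ideal _) : Set (MvPolynomial (Fin (N + 1)) ℂ))).Nonempty :=
      M.zeroSet_nonempty_of_isRelevant h𝔠hom h𝔊𝔠 h𝔠rel
    have hv𝔠 : M.vanishing (M.zeroSet ((𝔠 : Ideal _) : Set (MvPolynomial (Fin (N + 1)) ℂ))) = 𝔠 :=
      M.vanishing_zeroSet_eq_of_isPrime h𝔠hom h𝔊𝔠 h𝔠rel
    have hdimeq := M.coneDim_eq hne
    rw [hv𝔠] at hdimeq
    calc ringKrullDim (MvPolynomial (Fin (N + 1)) ℂ ⧸ 𝔭')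
        ≤ ringKrullDim (MvPolynomial (Fin (N + 1)) ℂ ⧸ 𝔠) :=
          ringKrullDim_le_of_surjective (Ideal.Quotient.factor h𝔠le) (Ideal.Quotient.factor_surjective _)
      _ = M.coneDim (M.zeroSet ((𝔠 : Ideal _) : Set (MvPolynomial (Fin (N + 1)) ℂ))) := hdimeq.symm
      _ ≤ ((n + 1 - r' : ℕ) : WithBot ℕ∞) := by
          have : M.coneDim (M.zeroSet ((𝔠 : Ideal _) : Set (MvPolynomial (Fin (N + 1)) ℂ))) ≤ n + 1 - r' := by omega
          exact_mod_cast this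
  have hFdeg : (↑Fs : Set (MvPolynomial (Fin (N + 1)) ℂ)) ⊆ (ZeroEst.Fil (N := N) (M.lawDeg * D) : Set (MvPolynomial (Fin (N + 1)) ℂ)) := by
    intro f hf
    have hf' := M.isHomogeneous_of_mem_derivGens hP (hFsF hf)
    rw [SetLike.mem_coe, ZeroEst.mem_Fil]
    by_cases h0 : f = 0
    · rw [h0, totalDegree_zero]; exact Nat.zero_le _
    · rw [hf'.totalDegree h0]
  obtain ⟨𝔍, h𝔍le, h𝔍bd⟩ := M.exists_ideal_hilbC_le 𝔭 h𝔭p Fs r' hr'le hDH h𝔭hom h𝔭𝔊 h𝔭rel hFdeg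
    (fun Y => (hFsF.trans hFgen𝔄).trans (h𝔄le Y))
  have h𝔍𝔮 : 𝔍 ≤ Finset.univ.inf fun Y => GaGm.loc (𝔭 Y) (h𝔭p Y) 𝔄 :=
    Finset.le_inf fun Y _ => (h𝔍le Y).trans (GaGm.loc_mono (h𝔭p Y) hspanFs𝔄)
  -- the comparison of leading coefficients
  set Kb := 2 ^ ((n + 1) * r') * (M.lawDeg * D) ^ r' * M.hilbConst with hKb
  have hexp : n + 1 - r' = m₀ := by omega
  have hmain : ∀ t, δ + Finset.univ.sup (fun Y => cY Y * T + aY Y) ≤ t →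
      ∑ Y ∈ (Finset.univ : Finset ↥𝓨), ((T + s).choose s * ρY Y) * (t - (δ + cY Y * T + aY Y) + m₀).choose m₀ ≤
        (Kb * m₀.factorial) * (t + 0 + m₀).choose m₀ := by
    intro t ht
    have hY : ∀ Y : ↥𝓨, cY Y * T + aY Y ≤ Finset.univ.sup (fun Y => cY Y * T + aY Y) := fun Y =>
      Finset.le_sup (f := fun Y => cY Y * T + aY Y) (Finset.mem_univ Y)
    calc ∑ Y ∈ (Finset.univ : Finset ↥𝓨), ((T + s).choose s * ρY Y) * (t - (δ + cY Y * T + aY Y) + m₀).choose m₀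
        ≤ ∑ Y ∈ (Finset.univ : Finset ↥𝓨), ZeroEst.hilbC (N := N) ((GaGm.loc (𝔭 Y) (h𝔭p Y) 𝔄).restrictScalars ℂ) (t - δ) := by
          refine Finset.sum_le_sum fun Y _ => ?_
          have h1 := haY Y (t - δ - cY Y * T) (by have := hY Y; omega)
          have h2 := hcY Y (t - δ - cY Y * T)
          have e1 : t - δ - cY Y * T - aY Y = t - (δ + cY Y * T + aY Y) := by omega
          have e2 : t - δ - cY Y * T + cY Y * T = t - δ := by have := hY Y; omega
          rw [e1] at h1
          rw [e2] at h2
          calc (T + s).choose s * ρY Y * (t - (δ + cY Y * T + aY Y) + m₀).choose m₀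
              = (T + s).choose s * (ρY Y * (t - (δ + cY Y * T + aY Y) + m₀).choose m₀) := by ring
            _ ≤ (T + s).choose s * ZeroEst.hilbC (N := N) ((𝔭 Y).restrictScalars ℂ) (t - δ - cY Y * T) :=
                Nat.mul_le_mul_left _ h1
            _ ≤ _ := h2
      _ ≤ ZeroEst.hilbC (N := N) ((Finset.univ.inf fun Y => GaGm.loc (𝔭 Y) (h𝔭p Y) 𝔄).restrictScalars ℂ) t := hδ t (by omega)
      _ ≤ ZeroEst.hilbC (N := N) (𝔍.restrictScalars ℂ) t := ZeroEst.hilbC_antitone (fun x hx => h𝔍𝔮 hx) t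
      _ ≤ Kb * (t + 1) ^ (n + 1 - r') := h𝔍bd t
      _ = Kb * (t + 1) ^ m₀ := by rw [hexp]
      _ ≤ Kb * (m₀.factorial * (t + m₀).choose m₀) := Nat.mul_le_mul_left _ (GaGm.pow_succ_le_factorial_mul_choose t m₀)
      _ = (Kb * m₀.factorial) * (t + 0 + m₀).choose m₀ := by rw [Nat.add_zero]; ring
  have hsum := GaGm.Asymp.sum_le_of_choose_ineq (Finset.univ : Finset ↥𝓨) (Kb * m₀.factorial)
    (fun Y => (T + s).choose s * ρY Y) (fun Y => δ + cY Y * T + aY Y) 0 m₀ _ hmain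
  -- `card 𝓨 · binom ≤ ∑_Y binom ρ_Y`
  have hcard : 𝓨.card * (T + s).choose s ≤ ∑ Y ∈ (Finset.univ : Finset ↥𝓨), (T + s).choose s * ρY Y := by
    calc 𝓨.card * (T + s).choose s = ∑ Y ∈ (Finset.univ : Finset ↥𝓨), (T + s).choose s := by
          rw [Finset.sum_const, smul_eq_mul, Finset.card_univ, Fintype.card_coe]
      _ ≤ _ := Finset.sum_le_sum fun Y _ => Nat.le_mul_of_pos_right _ (hρY Y)
  have hncard : ((fun σ => σ +ᵥ ((H₀ : AddSubgroup V) : Set V)) '' S).ncard = 𝓨.card := by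
    rw [show (fun σ => σ +ᵥ ((H₀ : AddSubgroup V) : Set V)) '' S = ↑𝓨 by
      rw [h𝓨, Finset.coe_image, hSfin.coe_toFinset], Set.ncard_coe_finset]
  -- the constant
  have hconst : Kb * m₀.factorial * D ^ (m₀ - 1) ≤ M.mainConst * D ^ n := by
    have h1 : m₀.factorial ≤ (n + 1).factorial := Nat.factorial_le (by omega)
    have h2 : 2 ^ ((n + 1) * r') ≤ 2 ^ ((n + 1) * (n + 1)) := Nat.pow_le_pow_right (by norm_num) (Nat.mul_le_mul_left _ hr'le)
    have h3 : M.lawDeg ^ r' ≤ M.lawDeg ^ (n + 1) := Nat.pow_le_pow_right hc hr'le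
    have h4 : D ^ r' * D ^ (m₀ - 1) = D ^ n := by rw [← pow_add]; congr 1; omega
    calc Kb * m₀.factorial * D ^ (m₀ - 1)
        = 2 ^ ((n + 1) * r') * M.lawDeg ^ r' * M.hilbConst * m₀.factorial * (D ^ r' * D ^ (m₀ - 1)) := by
          rw [hKb, mul_pow]; ring
      _ ≤ 2 ^ ((n + 1) * (n + 1)) * M.lawDeg ^ (n + 1) * M.hilbConst * (n + 1).factorial * (D ^ r' * D ^ (m₀ - 1)) := by
          gcongr
      _ = M.mainConst * D ^ n := by rw [h4, mainConst]
  -- assemble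
  rw [hncard]
  calc (T + s).choose s * 𝓨.card * D ^ (m₀ - 1)
      = (𝓨.card * (T + s).choose s) * D ^ (m₀ - 1) := by ring
    _ ≤ (∑ Y ∈ (Finset.univ : Finset ↥𝓨), (T + s).choose s * ρY Y) * D ^ (m₀ - 1) := Nat.mul_le_mul_right _ hcard
    _ ≤ (Kb * m₀.factorial) * D ^ (m₀ - 1) := Nat.mul_le_mul_right _ hsum
    _ ≤ M.mainConst * D ^ n := hconst

end AnalyticGroupModel

end Literature.NumberTheory.Transcendental
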